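import Summits.Ventures.CertifiedManyBodySolver.Transport.LTIPrimalHubbardChainWindow
import HarnessLib

/-!
# Ventures/CertifiedManyBodySolver — Transport/ChainWindowShift.lean

Speedrun cell sr-mbsolver — LIT team (lit-1 gen-6), D-19 r104/r108/r113 (ENT-B0 transport, part 1 of 3).
HONEST FRAMING: first certified bounds; not a superconductivity verdict; every number certified or labelled float.

Spin-side bookkeeping for window states of the Jordan–Wigner chain (`Op (PolySite Λ) 4`, product basis `siteOcc`):
* translations of chain site sets as embeddings `PolySite Λ ↪ PolySite W` (`shiftByEmb`; an embedding is determined by its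
  translation length, `embedding_eq_of_shift`);
* **shift consistency** (`spinPartialTrace_eq_of_shift`): ONE local-translation-invariance row `tr_L σ = tr_R σ` of a window state
  `σ` makes every translated copy of every sub-window carry the same marginal (Kull–Schuch–Dive–Navascués §II.A–B; Fawzi–Fawzi–Scalet
  §4, `LocTI`) — functoriality of the tree's `spinPartialTrace`;
* **restriction to a sub-window inherits the rows of the by-value node** of `Transport/LTIPrimalHubbardChain.lean`: sector zeros
  (`spinPartialTrace_apply_eq_zero_of_sector`), real entries (`conj_spinPartialTrace_apply`), and — for an initial segment, where no
  Jordan–Wigner string enters — expectations of window observables (`trace_toSpin_mul_spinPartialTrace_incl`).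
Used by `Transport/ChainWindowBlocks.lean` and `Transport/LTIPrimalHubbardChainEnt.lean` (the entropy row of lane-B `ent` certificates).
[cite: KullEtAl2024, §II.A–II.B] [cite: FawziFawziScalet2024Entropy, §4] [cite: NielsenChuang2010, §2.4.3]
-/

noncomputable section

open Matrix Complex Filter Topology
open scoped ComplexOrder
open Literature.Probability.LatticeModels
open Literature.MathematicalPhysics.QuantumLattice
open Literature.MathematicalPhysics.QuantumLattice.HubbardWave0
open Literature.MathematicalPhysics.QuantumLattice.ThermodynamicLimit
open Literature.MathematicalPhysics.QuantumLattice.JordanWigner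
open Literature.MathematicalPhysics.QuantumManyBody.StateRelaxation

namespace Summit.Ventures.CertifiedManyBodySolver.Transport

/-! ### Shift embeddings of site sets of the chain, and shift consistency of an LTI window state -/

section Shift

variable {Λ Λ' W : Finset (Site 1)}

/-! An embedding `φ : PolySite Λ ↪ PolySite W` of chain site sets is **the translation by `c`** when `(φ y)₀ = y₀ + c` for every
site `y`; in `d = 1` an embedding is determined by this datum (`embedding_eq_of_shift`). The condition is kept unbundled
(a hypothesis `∀ y, ofLex (φ y).1 0 = ofLex y.1 0 + c`). -/

/-- The inclusion of site sets is the translation by `0`. [folklore] -/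
theorem shift_incl (h : Λ ⊆ W) : ∀ y : PolySite Λ, ofLex (PolySite.incl h y).1 0 = ofLex y.1 0 + 0 := fun y => by
  rw [add_zero]
  rfl

/-- `y ↦ y + v` followed by an inclusion is the translation by `v₀`. [folklore] -/
theorem shift_affEmb_trans_incl (v : Site 1) (hsh : affShiftSet 1 v Λ ⊆ W) :
    ∀ y : PolySite Λ, ofLex (((PolySite.affEmb 1 v Λ).trans (PolySite.incl hsh)) y).1 0 = ofLex y.1 0 + v 0 := fun y => by
  simp only [Function.Embedding.trans_apply, PolySite.coe_incl, PolySite.ofLex_coe_affEmb, affSite_apply, Units.val_one,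
    one_mul]

/-- Translations compose additively. [folklore] -/
theorem shift_trans {φ : PolySite Λ ↪ PolySite Λ'} {ψ : PolySite Λ' ↪ PolySite W} {c c' : ℤ}
    (hφ : ∀ y, ofLex (φ y).1 0 = ofLex y.1 0 + c) (hψ : ∀ y, ofLex (ψ y).1 0 = ofLex y.1 0 + c') :
    ∀ y, ofLex ((φ.trans ψ) y).1 0 = ofLex y.1 0 + (c + c') := fun y => by
  rw [Function.Embedding.trans_apply, hψ, hφ, add_assoc]

/-- **An embedding of chain site sets is determined by its translation length.** [folklore] -/
theorem embedding_eq_of_shift {φ ψ : PolySite Λ ↪ PolySite W} {c : ℤ} (hφ : ∀ y, ofLex (φ y).1 0 = ofLex y.1 0 + c)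
    (hψ : ∀ y, ofLex (ψ y).1 0 = ofLex y.1 0 + c) : φ = ψ := by
  refine DFunLike.ext _ _ fun y => Subtype.ext ?_
  have h : ofLex (φ y).1 = ofLex (ψ y).1 := funext fun i => by rw [Subsingleton.elim i 0, hφ, hψ]
  exact congrArg toLex h

/-- **The translation by `c` as an embedding of site sets** `PolySite Λ ↪ PolySite W`, when `Λ + c ⊆ W`. [folklore] -/
def shiftByEmb (Λ W : Finset (Site 1)) (c : ℤ) (h : ∀ x ∈ Λ, (fun _ => x 0 + c : Site 1) ∈ W) :
    PolySite Λ ↪ PolySite W :=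
  ⟨fun y => PolySite.pt (fun _ => ofLex y.1 0 + c) (h _ (PolySite.ofLex_mem y)), fun y y' hyy => by
    have h1 : ofLex y.1 0 + c = ofLex y'.1 0 + c := congrArg (fun z : PolySite W => ofLex z.1 0) hyy
    refine Subtype.ext ?_
    have h2 : ofLex y.1 = ofLex y'.1 := funext fun i => by
      rw [Subsingleton.elim i 0]
      exact add_right_cancel h1
    exact congrArg toLex h2⟩

/-- The underlying site of `shiftByEmb Λ W c h y` is `y + c`. [folklore] -/
@[simp] theorem ofLex_coe_shiftByEmb (c : ℤ) (h : ∀ x ∈ Λ, (fun _ => x 0 + c : Site 1) ∈ W) (y : PolySite Λ) :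
    ofLex (shiftByEmb Λ W c h y).1 = fun _ => ofLex y.1 0 + c := rfl

/-- `shiftByEmb Λ W c h` is the translation by `c`. [folklore] -/
theorem shift_shiftByEmb (c : ℤ) (h : ∀ x ∈ Λ, (fun _ => x 0 + c : Site 1) ∈ W) :
    ∀ y, ofLex (shiftByEmb Λ W c h y).1 0 = ofLex y.1 0 + c := fun _ => rfl

/-- **Shift consistency of a locally translation invariant window state** (Kull–Schuch–Dive–Navascués §II.A–B: the reduced states
of ONE window state with `tr_L ρ = tr_R ρ` are consistent under all translations inside the window). If the marginals of
`σ ∈ 𝔄_{\{a,…,b+1\}}` on `{a,…,b}` and on its unit translate `{a+1,…,b+1}` agree (`φ₀`, `φ₁` the two embeddings), then for EVERY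
site set `Λ` and every translate `Λ + c ⊆ {a,…,b+1}` (`c ≥ 0`, embedding `ψ`) with `Λ ⊆ {a,…,b+1}` (embedding `ψ₀`) the two
marginals of `σ` agree: `tr_ψ σ = tr_{ψ₀} σ`. Induction on `c`, one unit translation at a time, by functoriality of the partial
trace (`spinPartialTrace_trans`). [cite: KullEtAl2024, §II.A–II.B] [cite: FawziFawziScalet2024Entropy, §4 (LocTI)] -/
theorem spinPartialTrace_eq_of_shift {q : ℕ} {a b : ℤ}
    {φ₀ φ₁ : PolySite (chainWindow a b) ↪ PolySite (chainWindow a (b + 1))}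
    (hφ₀ : ∀ y, ofLex (φ₀ y).1 0 = ofLex y.1 0 + 0) (hφ₁ : ∀ y, ofLex (φ₁ y).1 0 = ofLex y.1 0 + 1)
    {σ : Op (PolySite (chainWindow a (b + 1))) q}
    (hLTI : spinPartialTrace φ₁ σ = spinPartialTrace φ₀ σ)
    (c : ℕ) {ψ ψ₀ : PolySite Λ ↪ PolySite (chainWindow a (b + 1))}
    (hψ : ∀ y, ofLex (ψ y).1 0 = ofLex y.1 0 + (c : ℤ)) (hψ₀ : ∀ y, ofLex (ψ₀ y).1 0 = ofLex y.1 0 + 0) :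
    spinPartialTrace ψ σ = spinPartialTrace ψ₀ σ := by
  induction c generalizing ψ with
  | zero =>
    simp only [Nat.cast_zero] at hψ
    rw [embedding_eq_of_shift hψ hψ₀]
  | succ c ih =>
    have hc : ((c + 1 : ℕ) : ℤ) = (c : ℤ) + 1 := by push_cast; ring
    simp only [hc] at hψ
    -- the translate by `c` still lies in the small window `{a, …, b}`
    have hmem : ∀ x ∈ Λ, (fun _ => x 0 + (c : ℤ) : Site 1) ∈ chainWindow a b := by
      intro x hx
      have h1 := mem_chainWindow.1 (PolySite.ofLex_mem (ψ (PolySite.pt x hx)))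
      have h0 := mem_chainWindow.1 (PolySite.ofLex_mem (ψ₀ (PolySite.pt x hx)))
      rw [hψ, PolySite.ofLex_coe_pt] at h1
      rw [hψ₀, PolySite.ofLex_coe_pt] at h0
      simp only [mem_chainWindow]
      omega
    have hψ' := shift_shiftByEmb (Λ := Λ) (c : ℤ) hmem
    have e1 : ψ = (shiftByEmb Λ (chainWindow a b) c hmem).trans φ₁ := embedding_eq_of_shift hψ (shift_trans hψ' hφ₁)
    have e0 : ∀ y, ofLex (((shiftByEmb Λ (chainWindow a b) c hmem).trans φ₀) y).1 0 = ofLex y.1 0 + (c : ℤ) := by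
      have h := shift_trans hψ' hφ₀
      simp only [add_zero] at h
      exact h
    rw [e1, spinPartialTrace_trans, hLTI, ← spinPartialTrace_trans]
    exact ih e0

end Shift

/-! ### Restriction of a window state to a sub-window: the rows of the node are inherited -/

section SubWindow

variable {X Y : Type*} [Fintype X] [DecidableEq X] [Fintype Y] [DecidableEq Y]

omit [DecidableEq X] in
/-- Spin-`s` counts of two configurations of `Y` that agree off the range of `φ : X ↪ Y` differ exactly by the difference of the
counts of their pull-backs to `X` (stated additively, over `ℕ`). [folklore] -/
theorem sum_siteOcc_add_eq (φ : X ↪ Y) (s : Fin 2) {k k' : TensorIndex Y 4}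
    (h : ∀ y, y ∉ Set.range φ → k y = k' y) :
    (∑ y, if s ∈ siteOcc (k y) then 1 else 0 : ℕ) + (∑ x, if s ∈ siteOcc (k' (φ x)) then 1 else 0 : ℕ) =
      (∑ y, if s ∈ siteOcc (k' y) then 1 else 0 : ℕ) + (∑ x, if s ∈ siteOcc (k (φ x)) then 1 else 0 : ℕ) := by
  classical
  have split : ∀ k : TensorIndex Y 4, (∑ y, if s ∈ siteOcc (k y) then 1 else 0 : ℕ) =
      (∑ x, if s ∈ siteOcc (k (φ x)) then 1 else 0 : ℕ) +
        ∑ y ∈ Finset.univ.filter (fun y => y ∉ Set.range φ), (if s ∈ siteOcc (k y) then 1 else 0 : ℕ) := by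
    intro k
    rw [← Finset.sum_filter_add_sum_filter_not Finset.univ (fun y => y ∈ Set.range φ)]
    congr 1
    have hset : Finset.univ.filter (fun y => y ∈ Set.range φ) = Finset.univ.map φ := by
      ext y
      simp only [Finset.mem_filter, Finset.mem_univ, true_and, Finset.mem_map, Set.mem_range]
    rw [hset, Finset.sum_map]
  have hoff : ∑ y ∈ Finset.univ.filter (fun y => y ∉ Set.range φ), (if s ∈ siteOcc (k y) then 1 else 0 : ℕ) =
      ∑ y ∈ Finset.univ.filter (fun y => y ∉ Set.range φ), (if s ∈ siteOcc (k' y) then 1 else 0 : ℕ) :=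
    Finset.sum_congr rfl fun y hy => by rw [h y (Finset.mem_filter.1 hy).2]
  rw [split k, split k', hoff]
  ring

/-- **Sector zeros are inherited by marginals**: if `σ ∈ 𝔄_Y` vanishes between product-basis configurations with different
spin-`s` counts, so does every partial trace `tr_φ σ` (the traced-out sites carry the same configuration on both sides).
[cite: KullEtAl2024, §II.B] -/
theorem spinPartialTrace_apply_eq_zero_of_sector (φ : X ↪ Y) {σ : Op Y 4} (s : Fin 2)
    (hsec : ∀ k k' : TensorIndex Y 4,
      (∑ y, if s ∈ siteOcc (k y) then 1 else 0 : ℕ) ≠ (∑ y, if s ∈ siteOcc (k' y) then 1 else 0 : ℕ) → σ k k' = 0)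
    {t t' : TensorIndex X 4}
    (hne : (∑ x, if s ∈ siteOcc (t x) then 1 else 0 : ℕ) ≠ (∑ x, if s ∈ siteOcc (t' x) then 1 else 0 : ℕ)) :
    spinPartialTrace φ σ t t' = 0 := by
  rw [spinPartialTrace_apply, Matrix.trace]
  refine Finset.sum_eq_zero fun a _ => ?_
  rw [Matrix.diag_apply, Matrix.mul_apply]
  refine Finset.sum_eq_zero fun b _ => ?_
  rw [spinEmbed_apply]
  split_ifs with hab
  · rw [Matrix.single_apply]
    split_ifs with hst
    · obtain ⟨h1, h2⟩ := hst
      have e1 : (∑ x, if s ∈ siteOcc (t' x) then 1 else 0 : ℕ) = (∑ x, if s ∈ siteOcc (a (φ x)) then 1 else 0 : ℕ) := by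
        rw [h1]
      have e2 : (∑ x, if s ∈ siteOcc (t x) then 1 else 0 : ℕ) = (∑ x, if s ∈ siteOcc (b (φ x)) then 1 else 0 : ℕ) := by
        rw [h2]
      have key := sum_siteOcc_add_eq φ s hab
      rw [hsec b a (by omega), mul_zero]
    · rw [zero_mul]
  · rw [zero_mul]

/-- **Real entries are inherited by marginals** (the embedded matrix units are `0/1` matrices). [folklore] -/
theorem conj_spinPartialTrace_apply (φ : X ↪ Y) {q : ℕ} {σ : Op Y q}
    (hreal : ∀ k k' : TensorIndex Y q, starRingEnd ℂ (σ k k') = σ k k') (t t' : TensorIndex X q) :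
    starRingEnd ℂ (spinPartialTrace φ σ t t') = spinPartialTrace φ σ t t' := by
  rw [spinPartialTrace_apply, Matrix.trace]
  simp only [Matrix.diag_apply, Matrix.mul_apply, map_sum, map_mul, hreal]
  refine Finset.sum_congr rfl fun a _ => Finset.sum_congr rfl fun b _ => ?_
  congr 1
  rw [spinEmbed_apply, Matrix.single_apply]
  split_ifs <;> simp

variable {d : ℕ} {Λ₁ Λ₂ : Finset (Site d)}

/-- **Even (here: all) observables of an initial segment keep their expectation in the marginal**: for a sub-window
`Λ₁ ⊆ Λ₂` whose sites form a lower set, `tr (toSpin a · tr_{Λ₂∖Λ₁} σ) = tr (toSpin (Γ(incl) a) · σ)` — no Jordan–Wigner string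
enters (`toSpin_fermionEmbed_of_strictMono_of_isLowerSet`). [cite: KullEtAl2024, §II.B eq. (locTIn)] [cite: EvansKawahigashi1998, §6.5] -/
theorem trace_toSpin_mul_spinPartialTrace_incl (h : Λ₁ ⊆ Λ₂) (hlow : IsLowerSet (Set.range (PolySite.incl h)))
    (a : FermionOp Λ₁) (σ : Op (PolySite Λ₂) 4) :
    (toSpin a * spinPartialTrace (PolySite.incl h) σ).trace = (toSpin (fermionEmbed (PolySite.incl h) a) * σ).trace := by
  rw [trace_mul_spinPartialTrace, toSpin_fermionEmbed_of_strictMono_of_isLowerSet _ (strictMono_incl h) hlow]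

end SubWindow

end Summit.Ventures.CertifiedManyBodySolver.Transport
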